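import Literature.AlgebraicGeometry.FundamentalGroup.RiemannExistenceCurveCharts
import Literature.RingTheory.IntegralClosure.IntegralElementCriticalValues
import Literature.AlgebraicGeometry.FundamentalGroup.RiemannExistenceLineProjection
import Mathlib.Analysis.Calculus.Deriv.Polynomial
import Mathlib.Analysis.Calculus.Deriv.Pow
import Mathlib.Analysis.Calculus.Deriv.Mul
import HarnessLib

/-!
# The critical values of a finite projection of a smooth affine curve to the line are finite

Layer `Literature/AlgebraicGeometry/FundamentalGroup`, an input of the curve case of Riemann's
existence theorem (SGA1 XII Thm. 5.1). Let `S` be an affine integral `ℂ`-scheme, smooth of relative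
dimension `1`, `A = Γ(S, 𝒪_S)`, and `f ∈ A` such that `A` is integral over `ℂ[f]` (a finite
projection `f : S → 𝔸¹`, Noether normalisation). Then there is a FINITE set `Δ ⊆ ℂ` such that at
every complex point `P` with `f(P) ∉ Δ` the derivative of `f` in the algebraic chart at `P` does not
vanish (`exists_finset_deriv_ne_zero`) — so that `f` is a local biholomorphism there. This is the
statement "a finite morphism of curves in characteristic `0` is unramified outside finitely many
points" (Shafarevich, *Basic Algebraic Geometry* II §5.3 Thm. 7; SGA1 I 9.11 / XII 5.2), proved here
transcendentally-cum-algebraically: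

* ALGEBRA (`Literature.RingTheory.IntegralClosure.exists_monic_derivative_dvd`): every `u ∈ A` has a
  monic equation `P_u(f, u) = 0` over `ℂ[f]` and a non-zero `b_u ∈ ℂ[t]` with `b_u(f) ∈ ∂_u P_u(f, u) · A`;
* ANALYSIS (this file): differentiating `P_u(f, u) = 0` along the chart at `P` (`hasDerivAt_eval_map`),
  `df(P) = 0` and `b_u(f(P)) ≠ 0` force `du(P) = 0`; if this holds for a finite set of GENERATORS `u`
  of the `ℂ`-algebra `A` then `da(P) = 0` for all `a ∈ A` (`deriv` along the chart is a derivation,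
  `Algebra.adjoin_induction`), which contradicts the chart coordinate being a quotient `a/g` of
  elements of `A` near `P` (`exists_eval_mul_eq_eval_nhds`, the stalk as a localisation of `A`) with
  derivative `1`. Hence `Δ = ⋃_u {b_u = 0}` works.

Everything is proved; there are no definitions (the structure map `structureMap S : ℂ →+* Γ(S, 𝒪_S)` and
its evaluation lemmas are in `RiemannExistenceLineProjection`).

## References

* I. R. Shafarevich, *Basic Algebraic Geometry*, Grundlehren 213, Springer (1974), Ch. II §5.3
  Thm. 7. [Shafarevich1974]
* A. Grothendieck, M. Raynaud, *SGA 1*, Exp. XII Thm. 5.1, Prop. 5.2. [SGA1]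
-/

noncomputable section

open scoped Manifold ContDiff Topology Polynomial
open CategoryTheory AlgebraicGeometry Set Filter Function Polynomial
open Literature.AlgebraicGeometry.Motives
open Literature.AlgebraicGeometry.Motives.AlgPoints (evalOrZero evalOrZero_of_mem)
open Literature.Geometry.Kaehler.RiemannSurface

namespace Literature.AlgebraicGeometry.FundamentalGroup

open LineProjection

namespace CurveCharts

/-! ### A calculus lemma: differentiating a polynomial relation in two holomorphic functions -/

/-- **Chain rule for `P(y(z))(x(z))`**, `P ∈ ℂ[y][x]`: its derivative at `z₀` is
`x' · (∂ₓP)(y₀)(x₀) + y' · Σ_k (P_k)'(y₀) x₀^k`. [folklore] -/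
theorem hasDerivAt_eval_map {y x : ℂ → ℂ} {y' x' z₀ : ℂ} (hy : HasDerivAt y y' z₀) (hx : HasDerivAt x x' z₀)
    (P : ℂ[X][X]) :
    HasDerivAt (fun z ↦ (P.map (evalRingHom (y z))).eval (x z))
      (x' * ((derivative P).map (evalRingHom (y z₀))).eval (x z₀) +
        y' * ∑ k ∈ Finset.range (P.natDegree + 1), (derivative (P.coeff k)).eval (y z₀) * x z₀ ^ k) z₀ := by
  set n := P.natDegree + 1 with hn
  -- the function as a finite sum
  have hfun : (fun z ↦ (P.map (evalRingHom (y z))).eval (x z)) =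
      fun z ↦ ∑ k ∈ Finset.range n, (P.coeff k).eval (y z) * x z ^ k := by
    funext z
    rw [eval_map, eval₂_eq_sum_range]
    rfl
  -- the derivative of `∂ₓ P` as a finite sum
  have hD : ((derivative P).map (evalRingHom (y z₀))).eval (x z₀) =
      ∑ k ∈ Finset.range n, (P.coeff k).eval (y z₀) * k * x z₀ ^ (k - 1) := by
    rw [← derivative_map, derivative_eval, sum_over_range' _ _ n]
    · simp only [coeff_map, coe_evalRingHom]
    · exact (natDegree_map_le).trans_lt (Nat.lt_succ_self _)
    · intro k
      rw [zero_mul, zero_mul]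
  rw [hfun, hD, Finset.mul_sum, Finset.mul_sum, ← Finset.sum_add_distrib]
  refine HasDerivAt.fun_sum fun k _ ↦ ?_
  have h1 : HasDerivAt (fun z ↦ (P.coeff k).eval (y z)) ((derivative (P.coeff k)).eval (y z₀) * y') z₀ :=
    ((P.coeff k).hasDerivAt (y z₀)).comp z₀ hy
  have h2 : HasDerivAt (fun z ↦ x z ^ k) ((k : ℂ) * x z₀ ^ (k - 1) * x') z₀ := hx.fun_pow k
  exact (h1.fun_mul h2).congr_deriv (by ring)

variable (S : SchemeOver ℂ)

/-! ### The chart coordinate is locally a quotient of global functions -/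

/-- **A section near a point of an affine scheme is locally a quotient of global sections**: for
`x ∈ Γ(S, U)` and a complex point `P ∈ U(ℂ)` there are `a, g ∈ Γ(S, 𝒪_S)` with `g(P) ≠ 0` and
`x(Q) · g(Q) = a(Q)` for `Q` near `P` (the stalk `𝒪_{S,P}` is the localisation of `Γ(S, 𝒪_S)`,
Mathlib's `IsAffineOpen.isLocalization_stalk`). [folklore] -/
theorem exists_eval_mul_eq_eval_nhds [IsAffine S.left] {U : S.left.Opens} (x : Γ(S.left, U)) (P : ComplexPoints S)
    (hP : P.pt ∈ U) :
    ∃ (a g : Γ(S.left, ⊤)) (W : S.left.Opens), P.pt ∈ W ∧ P.eval ⊤ trivial g ≠ 0 ∧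
      ∀ (Q : ComplexPoints S) (hQ : Q.pt ∈ W), ∃ hQU : Q.pt ∈ U, Q.eval U hQU x * Q.eval ⊤ trivial g = Q.eval ⊤ trivial a := by
  letI := TopCat.Presheaf.algebra_section_stalk S.left.presheaf (⟨P.pt, trivial⟩ : (⊤ : S.left.Opens))
  haveI hloc := (isAffineOpen_top S.left).isLocalization_stalk ⟨P.pt, trivial⟩
  set 𝔭 := ((isAffineOpen_top S.left).primeIdealOf ⟨P.pt, trivial⟩).asIdeal with h𝔭
  obtain ⟨⟨a, g⟩, hag⟩ := IsLocalization.surj 𝔭.primeCompl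
    (S := S.left.presheaf.stalk ((⟨P.pt, trivial⟩ : (⊤ : S.left.Opens)) : S.left)) (S.left.presheaf.germ U P.pt hP x)
  simp only at hag
  have halg : algebraMap Γ(S.left, ⊤) (S.left.presheaf.stalk ((⟨P.pt, trivial⟩ : (⊤ : S.left.Opens)) : S.left)) =
      (S.left.presheaf.germ ⊤ P.pt trivial).hom := rfl
  rw [halg] at hag
  -- `g(P) ≠ 0`
  have hgunit : IsUnit (S.left.presheaf.germ ⊤ P.pt trivial (g : Γ(S.left, ⊤))) := by
    have h := IsLocalization.map_units (S.left.presheaf.stalk ((⟨P.pt, trivial⟩ : (⊤ : S.left.Opens)) : S.left)) g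
    rwa [halg] at h
  have hgP : P.eval ⊤ trivial (g : Γ(S.left, ⊤)) ≠ 0 :=
    (AlgPoints.pt_mem_basicOpen_iff (U := ⊤) P trivial _).1
      ((S.left.mem_basicOpen (g : Γ(S.left, ⊤)) P.pt trivial).2 hgunit)
  -- the germ identity `germ (x * g|U) = germ (a|U)`
  have hgerm : S.left.presheaf.germ U P.pt hP (x * S.left.presheaf.map (homOfLE le_top).op (g : Γ(S.left, ⊤))) =
      S.left.presheaf.germ U P.pt hP (S.left.presheaf.map (homOfLE le_top).op a) := by
    rw [map_mul, TopCat.Presheaf.germ_res_apply, TopCat.Presheaf.germ_res_apply]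
    exact hag
  obtain ⟨W, hW, iU, iV, heq⟩ := TopCat.Presheaf.germ_eq _ _ hP hP _ _ hgerm
  refine ⟨a, g, W, hW, hgP, fun Q hQ ↦ ⟨iU.le hQ, ?_⟩⟩
  have hiU : iU = homOfLE iU.le := Subsingleton.elim _ _
  have hiV : iV = homOfLE iV.le := Subsingleton.elim _ _
  rw [hiU, hiV] at heq
  have h := congr_arg (Q.eval W hQ) heq
  rw [AlgPoints.eval_res Q iU.le hQ, AlgPoints.eval_res Q iV.le hQ, ← AlgPoints.evalRingHom_apply, map_mul,
    AlgPoints.evalRingHom_apply, AlgPoints.evalRingHom_apply, AlgPoints.eval_res Q le_top, AlgPoints.eval_res Q le_top] at h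
  convert h using 2

/-! ### The derivation along the algebraic chart -/

section Chart

variable [LocallyOfFiniteType S.hom] [SmoothOfRelativeDimension 1 S.hom]

/-- The chart expression `z ↦ a((algChart P)⁻¹ z)` of a global function is `C^ω` on the chart target.
[cite: SerreGAGA1956, §2 n°5 Prop. 2] -/
theorem contDiffOn_eval_algChart_symm [IsAffine S.left] (P : ComplexPoints S) (a : Γ(S.left, ⊤)) :
    ContDiffOn ℂ ω (fun z ↦ ((algChart S P).symm z).eval ⊤ trivial a) (algChart S P).target := by
  have h := algChart_hol S P ⟨⊤, isAffineOpen_top _⟩ a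
  have hset : (algChart S P).target ∩ (algChart S P).symm ⁻¹' {Q | Q.pt ∈ ((⟨⊤, isAffineOpen_top S.left⟩ : S.left.affineOpens) : S.left.Opens)} =
      (algChart S P).target := inter_eq_left.2 fun _ _ ↦ trivial
  rw [hset] at h
  refine h.congr fun z _ ↦ ?_
  exact (evalOrZero_of_mem (U := (⊤ : S.left.Opens)) a
    (show ((algChart S P).symm z).pt ∈ (⊤ : S.left.Opens) from trivial)).symm

/-- The chart expression of a global function is differentiable at the image of the centre. [folklore] -/
theorem differentiableAt_eval_algChart_symm [IsAffine S.left] (P : ComplexPoints S) (a : Γ(S.left, ⊤)) :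
    DifferentiableAt ℂ (fun z ↦ ((algChart S P).symm z).eval ⊤ trivial a) (algChart S P P) :=
  ((contDiffOn_eval_algChart_symm S P a).differentiableOn (by simp)).differentiableAt
    ((algChart S P).open_target.mem_nhds ((algChart S P).map_source (mem_algChart_source S P)))

/-- **The chart derivative at `P` is a derivation which does not vanish identically** (the chart
coordinate is locally `a/g` with `a, g ∈ Γ(S, 𝒪_S)` and has derivative `1`). [folklore] -/
theorem exists_deriv_eval_algChart_symm_ne_zero [IsAffine S.left] (P : ComplexPoints S) :
    ∃ a : Γ(S.left, ⊤), deriv (fun z ↦ ((algChart S P).symm z).eval ⊤ trivial a) (algChart S P P) ≠ 0 := by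
  by_contra hall
  push Not at hall
  set c := algChart S P with hc
  set z₀ := c P with hz₀
  obtain ⟨U, x, hsrc, hx⟩ := algChart_alg S P
  have hPU : P.pt ∈ (↑U : S.left.Opens) := hsrc (mem_algChart_source S P)
  obtain ⟨a, g, W, hW, hgP, hW'⟩ := exists_eval_mul_eq_eval_nhds S x P hPU
  -- the coordinate `z ↦ x(c⁻¹ z)` is the identity on the target
  have hid : ∀ z ∈ c.target, ∀ hz : (c.symm z).pt ∈ (↑U : S.left.Opens), (c.symm z).eval ↑U hz x = z := by
    intro z hz hzU
    have h1 := hx (c.symm z) (c.map_target hz)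
    rw [evalOrZero_of_mem x hzU, c.right_inv hz] at h1
    exact h1.symm
  -- near `z₀`, `z * g(c⁻¹ z) = a(c⁻¹ z)`
  have hnear : (fun z ↦ z * (c.symm z).eval ⊤ trivial g) =ᶠ[𝓝 z₀] fun z ↦ (c.symm z).eval ⊤ trivial a := by
    have h1 : ∀ᶠ z in 𝓝 z₀, z ∈ c.target := c.open_target.mem_nhds (c.map_source (mem_algChart_source S P))
    have h2 : ∀ᶠ z in 𝓝 z₀, (c.symm z).pt ∈ W := by
      have hcont : ContinuousAt c.symm z₀ := c.continuousAt_symm (c.map_source (mem_algChart_source S P))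
      have hopen : IsOpen {Q : ComplexPoints S | Q.pt ∈ W} := AlgPoints.isOpen_setOf_pt_mem W
      have hmem : c.symm z₀ ∈ {Q : ComplexPoints S | Q.pt ∈ W} := by
        rw [hz₀, c.left_inv (mem_algChart_source S P)]
        exact hW
      exact hcont.preimage_mem_nhds (hopen.mem_nhds hmem)
    filter_upwards [h1, h2] with z hz hzW
    obtain ⟨hzU, h⟩ := hW' (c.symm z) hzW
    rw [hid z hz hzU] at h
    exact h
  -- differentiate at `z₀`
  have hg := (differentiableAt_eval_algChart_symm S P g).hasDerivAt
  have ha := (differentiableAt_eval_algChart_symm S P a).hasDerivAt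
  rw [hall g] at hg
  rw [hall a] at ha
  have hprod := (hasDerivAt_id z₀).fun_mul hg
  have heq := (hprod.congr_of_eventuallyEq hnear.symm).unique ha
  simp only [one_mul, mul_zero, add_zero] at heq
  rw [hz₀, c.left_inv (mem_algChart_source S P)] at heq
  exact hgP heq

end Chart

/-! ### The critical values are finite -/

/-- **The critical values of a finite projection of a smooth affine curve are finite.** Let `S` be an
affine integral `ℂ`-scheme, smooth of relative dimension `1`, and `f ∈ A = Γ(S, 𝒪_S)` with `A`
integral over `ℂ[f]`. There is a finite `Δ ⊆ ℂ` such that for every complex point `P` with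
`f(P) ∉ Δ` the derivative of `f` in the algebraic chart at `P` is non-zero.
[cite: Shafarevich1974, Ch. II §5.3 Thm. 7] [cite: SGA1, Exp. XII Prop. 5.2] -/
theorem exists_finset_deriv_ne_zero [IsAffine S.left] [LocallyOfFiniteType S.hom] [SmoothOfRelativeDimension 1 S.hom]
    [IsIntegral S.left] (f : Γ(S.left, ⊤)) (hint : (eval₂RingHom (structureMap S) f).IsIntegral) :
    ∃ Δ : Finset ℂ, ∀ P : ComplexPoints S, P.eval ⊤ trivial f ∉ Δ →
      deriv (fun z ↦ ((algChart S P).symm z).eval ⊤ trivial f) (algChart S P P) ≠ 0 := by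
  classical
  haveI : Nonempty (⊤ : S.left.Opens) := ⟨⟨(IsIntegral.nonempty (X := S.left)).some, trivial⟩⟩
  -- `A` as an integral `ℂ[t]`-algebra through `f`, and as a finitely generated `ℂ`-algebra
  letI algR : Algebra ℂ[X] Γ(S.left, ⊤) := (eval₂RingHom (structureMap S) f).toAlgebra
  haveI : Algebra.IsIntegral ℂ[X] Γ(S.left, ⊤) := ⟨fun a ↦ hint a⟩
  have hunit : ∀ n : ℕ, n ≠ 0 → IsUnit (n : ℂ[X]) := fun n hn ↦ by
    rw [← C_eq_natCast]
    exact isUnit_C.2 (isUnit_iff_ne_zero.2 (Nat.cast_ne_zero.2 hn))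
  choose Pu bu Eu hPmonic hProot hb0 hbE using
    fun u : Γ(S.left, ⊤) ↦ Literature.RingTheory.IntegralClosure.exists_monic_derivative_dvd (R := ℂ[X]) hunit u
  letI algC : Algebra ℂ Γ(S.left, ⊤) := (structureMap S).toAlgebra
  have hft : Algebra.FiniteType ℂ Γ(S.left, ⊤) := finiteType_structureMap S
  obtain ⟨s, hs⟩ := hft.out
  -- the critical values
  refine ⟨s.biUnion fun u ↦ (bu u).roots.toFinset, fun P hP ↦ ?_⟩
  set c := algChart S P with hc
  set z₀ := c P with hz₀
  have hsymm : c.symm z₀ = P := by rw [hz₀, c.left_inv (mem_algChart_source S P)]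
  -- the chart expressions of global functions and their derivatives at `z₀`
  set fa : Γ(S.left, ⊤) → ℂ → ℂ := fun a z ↦ (c.symm z).eval ⊤ trivial a with hfa
  have hdiff : ∀ a, DifferentiableAt ℂ (fa a) z₀ := fun a ↦ differentiableAt_eval_algChart_symm S P a
  have hfa_mul : ∀ a b, fa (a * b) = fun z ↦ fa a z * fa b z := fun a b ↦ by
    funext z
    simp only [hfa, ← AlgPoints.evalRingHom_apply, map_mul]
  have hfa_add : ∀ a b, fa (a + b) = fun z ↦ fa a z + fa b z := fun a b ↦ by
    funext z
    simp only [hfa, ← AlgPoints.evalRingHom_apply, map_add]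
  have hfa_C : ∀ r : ℂ, fa (algebraMap ℂ Γ(S.left, ⊤) r) = fun _ ↦ r := fun r ↦ by
    funext z
    exact eval_structureMap S _ r
  intro hder
  -- Step A: the generators have vanishing derivative
  have hgen : ∀ u ∈ s, deriv (fa u) z₀ = 0 := by
    intro u hu
    -- `b_u (f(P)) ≠ 0`
    have hbu : (bu u).eval (P.eval ⊤ trivial f) ≠ 0 := by
      intro h0
      apply hP
      rw [Finset.mem_biUnion]
      refine ⟨u, hu, ?_⟩
      rw [Multiset.mem_toFinset, mem_roots (hb0 u)]
      exact h0
    -- the relation `P_u(f, u) = 0` read at the points near `P`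
    have hrel : ∀ z, ((Pu u).map (evalRingHom (fa f z))).eval (fa u z) = 0 := by
      intro z
      have h := congr_arg ((c.symm z).evalRingHom ⊤ trivial) (hProot u)
      rw [map_zero, aeval_def, hom_eval₂, RingHom.algebraMap_toAlgebra, evalRingHom_comp_eval₂RingHom,
        ← eval_map, AlgPoints.evalRingHom_apply] at h
      exact h
    -- differentiate it at `z₀`
    have hy := (hdiff f).hasDerivAt
    rw [hder] at hy
    have hx := (hdiff u).hasDerivAt
    have hD := hasDerivAt_eval_map hy hx (Pu u)
    have hzero : HasDerivAt (fun z ↦ ((Pu u).map (evalRingHom (fa f z))).eval (fa u z)) 0 z₀ := by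
      have : (fun z ↦ ((Pu u).map (evalRingHom (fa f z))).eval (fa u z)) = fun _ ↦ 0 := funext hrel
      rw [this]
      exact hasDerivAt_const z₀ 0
    have heq := hD.unique hzero
    rw [zero_mul, add_zero] at heq
    -- the factor `(∂_u P_u)(f(P), u(P)) = χ_P(P_u'(u))` does not vanish: it divides `b_u(f(P)) ≠ 0`
    have hDval : ((derivative (Pu u)).map (evalRingHom (fa f z₀))).eval (fa u z₀) =
        P.eval ⊤ trivial (aeval u (derivative (Pu u))) := by
      rw [aeval_def, ← AlgPoints.evalRingHom_apply, hom_eval₂, RingHom.algebraMap_toAlgebra,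
        evalRingHom_comp_eval₂RingHom, ← eval_map, AlgPoints.evalRingHom_apply]
      simp only [hfa, hsymm]
    have hDne : ((derivative (Pu u)).map (evalRingHom (fa f z₀))).eval (fa u z₀) ≠ 0 := by
      rw [hDval]
      intro h0
      apply hbu
      rw [← AlgPoints.evalRingHom_apply] at h0
      have h := congr_arg (P.evalRingHom ⊤ trivial) (hbE u)
      rw [map_mul, h0, zero_mul, RingHom.algebraMap_toAlgebra, ← RingHom.comp_apply, evalRingHom_comp_eval₂RingHom,
        coe_evalRingHom] at h
      exact h
    exact (mul_eq_zero.1 heq).resolve_right hDne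
  -- Step B: every global function has vanishing derivative (a derivation vanishing on generators)
  have hall : ∀ a : Γ(S.left, ⊤), deriv (fa a) z₀ = 0 := by
    intro a
    have ha : a ∈ Algebra.adjoin ℂ (↑s : Set Γ(S.left, ⊤)) := by rw [hs]; exact Algebra.mem_top
    refine Algebra.adjoin_induction (p := fun a _ ↦ deriv (fa a) z₀ = 0) ?_ ?_ ?_ ?_ ha
    · exact fun u hu ↦ hgen u hu
    · intro r
      rw [hfa_C r, deriv_const]
    · intro a b _ _ iha ihb
      rw [hfa_add, deriv_fun_add (hdiff a) (hdiff b), iha, ihb, add_zero]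
    · intro a b _ _ iha ihb
      rw [hfa_mul, deriv_fun_mul (hdiff a) (hdiff b), iha, ihb, zero_mul, mul_zero, add_zero]
  -- Step C: contradiction with the chart coordinate
  obtain ⟨a, ha⟩ := exists_deriv_eval_algChart_symm_ne_zero S P
  exact ha (hall a)

end CurveCharts

end Literature.AlgebraicGeometry.FundamentalGroup
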